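import Literature.NumberTheory.EllipticCurves.Disegni2017.ChiLineRankinSelberg
import Literature.NumberTheory.EllipticCurves.HeegnerPointsOfConductor
import HarnessLib

/-!
# Disegni 2017, Theorem B ÷ Yuan–Zhang–Zhang (1.1.3) AT THE BASE POINT `χ` OF THE CYCLOTOMIC LINE
# THROUGH `χ` — the `χ`-isotypic pairings of `H`-points and the two ratio clauses, TYPED AS
# PREDICATES (definitions + unfolding API; no named fact, nothing asserted; net debt `0`)

Topic `Literature/NumberTheory/EllipticCurves`, cluster `Disegni2017` (namespace = path). Companion of
`ChiLineRankinSelberg.lean` (Theorem A on the line through a general finite-order `χ`, the factor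
`Z°_p = zCirc`, `IsNotExceptionalAt`, the named fact `thmA_chiLine`) and of the cluster's
`CyclotomicLineRankinSelberg.lean` §4 (the same two ratio clauses at `χ = 𝟙_K`, `ArchRatioClause` /
`PAdicRatioClause` / `CycLineGrossZagierClauses`). Written by the typer seat `bsd-print-cf2-ty2` (g49)
on the planner's SUMMON (U5b′) (cell `bsd-print-cf2`, HOME `run/shared/lean/pub/bsd-print-cf2/`) for
road (C) `disegni-pair-two` of the crux `PrintCf2.SplitBadTwoRankOneOfFacts`. BSD is not proved by
any of this.

HONEST FRAMING — DEFINITIONS ONLY, for the reason the cluster gives (§«Vacuity» of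
`CyclotomicLineRankinSelberg.lean`) and the planner re-derived for this road (STATUS
2026-08-30T16:26:28Z): the tree's `p`-adic height data (`PAdicHeightDataK W p H`) are ABSTRACT
symmetric bilinear pairings vanishing on torsion; an `∃ DH`-form of Theorem B is contentless
(`chiPAdicPairing_zero`, `ChiPAdicRatioClause.coeff_one_eq_zero_of_zero`: the zero datum satisfies the
`p`-adic clause iff the cyclotomic derivative vanishes), and a `∀ DH`-form needs a CANONICITY predicate
pinning `DH` to THE Schneider / Mazur–Tate height over `H` — the tree has one only for `p` TOTALLY
SPLIT in the field of the points (`PAdicHeightDataK.IsCanonicalSq`, sigma-squared form), which is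
FALSE for the road-(C) points (they live over `H_χ`, ramified above `2`). So, exactly as the addord
cell did with `CycLineGrossZagierFact.delbourgoDatum_cycLineGrossZagier`, the CONTENT-BEARING statement
is the consumer's CONJOINED one — Disegni's clauses below for a datum `DH` ∧ the consumer's own
transport of `DH` to a datum it can pin (road (C): seams S1/S2 of the typing brief, the (U5d)
receptacle `IsCanonicalSqMinusTwist` on the member `W`, Bertrand (U5c)) —, and this file supplies
its Disegni-side conjunct `ChiLineGrossZagierClauses` with every hypothesis and locator recorded.

## The source, verbatim (arXiv:1510.02114v3 = Compos. Math. 153 (2017); held text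
## `paper:arxiv-1510.02114`, `pN Lk` = materialised page/line; Errata = JIMJ 22 (2023) §6, held
## `paper:arxiv-1907.13040` p0021)

[p3 L24–44] «Let `A` be parametrised by `X(𝔹)` and let `E` be a CM extension of `F` admitting an
`𝔸^∞`-embedding `E_{𝔸^∞} ↪ 𝔹^∞`, which we fix … each closed point of `X^{E^×}` is defined over
`E^{ab}` … We fix one such CM point `P`. Let … `χ : E^×\E^×_{𝔸^∞} → L(χ)^×` be a finite order Hecke
character such that `ω_A · χ|_{𝔸^{∞,×}} = 1`; we can view `χ` as a character of `𝒢_E` via the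
reciprocity map of class field theory (normalised, in this work, by sending uniformisers to geometric
Frobenii). For each `f ∈ π_A`, we then have a Heegner point
`P(f, χ) = ∫_{Gal(E^{ab}/E)} f(ι_ξ(P)^σ) ⊗ χ(σ) dσ ∈ A(χ)`. Here the integration uses the Haar
measure of total volume `1`, and `A(χ) := (A(E^{ab}) ⊗_M L(χ)_χ)^{Gal(E^{ab}/E)}`.» [p4 L24–47]
(1.1.2)–(1.1.4): «the multiplicity one result of Tunnell and Saito implies that for each bilinear
pairing `⟨ , ⟩ : A(χ) ⊗_{L(χ)} A^∨(χ⁻¹) → V` … there is an element `𝓛 ∈ V` such that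
`⟨P(f₁, χ), P(f₂, χ⁻¹)⟩ = 𝓛 · Q(f₁, f₂, χ)` for all `f₁ ∈ π`, `f₂ ∈ π^∨`. … When `⟨ , ⟩` is the
Néron–Tate height pairing valued in `ℂ ↩ M` … [yzz] yields
`𝓛 = (c_E/2) · π^{2[F:ℚ]}|D_F|^{1/2} L′(1/2, σ_{A,E}^ι ⊗ χ^ι)/(2L(1,η)L(1,σ_A^ι,ad))` (1.1.3), where
`c_E := ζ_F(2)/((π/2)^{[F:ℚ]}|D_E|^{1/2}L(1,η)) ∈ ℚ^×` (1.1.4).» [p4 L1–11] `Q = ∏_v Q_v` is «defined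
over `M` and independent of choices», a generator of the rank-one space (so `Q(f₁,f₂,χ) ≠ 0` for some
`f₁, f₂` whenever `H(π,χ) ≠ 0`). [p7 L30–48] «We assume [potential ordinarity] for all `v ∣ p`. One
then has a canonical `p`-adic height pairing `⟨ , ⟩ : A(F̄)_ℚ ⊗_M A^∨(F̄)_ℚ → Γ_F ⊗̂ L` (1.3.1) … Its
equivariance properties under the action of `𝒢_F` allow to deduce from it pairings
`⟨ , ⟩ : A(χ) ⊗_{L(χ)} A^∨(χ⁻¹) → Γ_F ⊗̂ L(χ)` (1.3.2) for any character `χ ∈ 𝒴^{l.c.}_L`. Suppose that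
`ℓ : Γ_F → L(χ)` is any continuous homomorphism such that, for all `v ∣ p`, `ℓ_v|_{𝒪_{F,v}^×} ≠ 0`;
we then call `ℓ` a ramified logarithm. … If `χ` is not exceptional …, then (1.3.2) is known to
coincide with the norm-adapted height pairings à la Schneider, by [Nekovář], and with the Mazur–Tate
height pairings, by [Iovita–Werner].» [p8 L1–7] «`𝒩*_{𝒴/𝒴′} ≅ 𝒪_𝒴 ⊗ (Γ_F ⊗̂ L)` … denote `d_F G`
its image; it can be thought of as the differential in the `1+δ` cyclotomic variable(s).» [p8 L9–18]
«Let `χ ∈ 𝒴^{l.c., an}` be a character such that `ε(A_E, χ) = −1` … Let `𝔹` be the incoherent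
quaternion algebra determined by (1.1.1) … **Theorem 2 (= Theorem B).** Suppose that for all `v ∣ p`,
`A/F_v` has potentially `𝔭`-ordinary good or semistable reduction, `E_v/F_v` is split, and `χ` is not
exceptional (Definition 4). Then for all `f₁ ∈ π_A`, `f₂ ∈ π_{A^∨}` we have
`⟨P(f₁, χ), P^∨(f₂, χ⁻¹)⟩ = (c_E/2) · ∏_{v∣p} Z°_v(χ_v)⁻¹ · d_F L_{p,α}(σ_{A,E})(χ) · Q(f₁, f₂, χ)` in
`𝒩*_{𝒴/𝒴′}|_χ ≅ Γ_F ⊗̂ L(χ)`.» ERRATA (p0021 L14–18): «Theorem B. The constant factor should be `c_E`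
and not `c_E/2` (the latter is, according to [1], the constant factor of the Gross–Zagier formula in
archimedean coefficients). … the direct analogue of `s ↦ L(1/2+s, σ_E, χ)` is
`χ_F ↦ L_p(σ_E)(χ·χ_F∘q)` (where `q` is the adelisation of the norm from `E` to `F`), whose derivative
at `χ_F = 𝟙` is twice our `d_F L_p(σ_E)(χ)`.»

## What is typed (`F = ℚ`, `E = K` imaginary quadratic, `p𝒪_K = 𝔭𝔭′` split, `A = E` an elliptic
## curve over `ℚ` with model `W`, points over a number field `H`), and why it follows

* THE POINTS. `A(χ)` is spanned by the projections `e_χ(y) := |G|⁻¹ Σ_{σ ∈ G} σ(y) ⊗ χ(σ)^{∓1}` of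
  points `y ∈ A(H)`, `H ⊃ K` a finite abelian extension through whose group `G = Gal(H/K)` the
  character factors (for `ω = 𝟙` the finite-order `χ` with `χ|_{𝔸^{∞,×}} = 1` are exactly the ring
  class characters, so `H` may be taken to be a ring class field — CST's `ringClassField K ι c` with
  `G = ringClassGal ι c`); Disegni's `P(f,χ)` IS such a projection of the `H`-point `y = f(ι_ξ P)`
  (up to the `ℚ`-denominators of the quasi-embedding `ι_ξ` and of `f ∈ Hom⁰`, cleared into `q`). By
  bilinearity and `G`-invariance of either height, `⟨e_χ y₁, e_{χ⁻¹} y₂⟩ = |G|⁻¹·Σ_σ χ(σ)^{±1}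
  ⟨σy₁, y₂⟩`. Hence the typed objects: `chiHeightPairing W H G χ y₁ y₂ = Σ_σ χ(σ)·⟨σy₁, y₂⟩_{NT,H}`
  (tree `heightPairing` over `H`, RELATIVE to `H` — so YZZ's absolute height is `[H:ℚ]⁻¹` times it,
  §7.1.1 of [yzz], the cluster's (c7) with `½ = [K:ℚ]⁻¹`) and `chiPAdicPairing ι W H DH G χ y₁ y₂ =
  Σ_σ ι⁻¹χ(σ)·⟨σy₁, y₂⟩_{DH}` for a `p`-adic datum `DH` on `E(H)` read as Disegni's (1.3.1)∘`ℓ`,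
  ABSOLUTELY normalised ((4.1.7): `ℓ_w := [F′:F]⁻¹ℓ_v∘N` — so it restricts to `E(ℚ)` with factor `1`,
  `PAdicHeightDataK.RestrictsToWith D 1`, the cluster's convention). `G ≤ Aut(H/ℚ)` and
  `χ : G →* ℂˣ` are PARAMETERS (no carrier for `X(𝔹)` is needed or introduced: in ratio form the
  points are ∃-quantified elements of `E(H)`); the dictionary between `χ` and its Hecke incarnation
  `χ_H : HeckeCharacter K` (reciprocity normalised GEOMETRICALLY [p3 L32]) is the consumer's — tree
  tools: `GaloisRepresentations.charHecke`, `HeckeCharacter.exists_framedArtinRep_of_isFiniteOrder`,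
  `CaiShuTian2014.IsInflationAlong`. Replacing `χ` by `χ⁻¹` consistently changes nothing
  (`L(σ_K ⊗ χ⁻¹) = L(σ_K ⊗ χ^c) = L(σ_K ⊗ χ)`, `Z°_p` is symmetric in `𝔭 ↔ 𝔭′`, and the lines
  through `χ` and `χ^c` carry the same function).
* (1.1.3) IN RATIO FORM (`ChiArchRatioClause`): `[H:ℚ]⁻¹ · chiHeightPairing = (q/2) · Car · Λ′(1)`
  for every entire continuation `Λ` of `rankinSelbergEulerProductHecke f χ_H` (Disegni's
  `L(s − 1/2, σ_{A,K} ⊗ χ)`; currency note (S5) of the companion file), `Car = π²/(2L(1,η)L(1,σ_A,ad))`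
  the archimedean constant SHARED with Theorem A, and `q = c_E·Q(f₁,f₂,χ)·(rational normalisations)`
  — the `½` kept visible because Theorem B (corrected) has `c_E` where (1.1.3) has `c_E/2`.
* THEOREM B IN RATIO FORM (`ChiPAdicRatioClause`): `chiPAdicPairing = σ₀ · ι⁻¹(q · Z°_p(χ_p)⁻¹) · ½ ·
  log_p(γ) · [T¹]G_χ` — `Z°_p(χ_p) = ∏_{v∣p}Z°_v(χ_v) = zCirc a N χ_H 𝔭 𝔭′` (companion file (E1)–(E2),
  non-zero iff `χ` is not exceptional at `𝔭` and `𝔭′`), `G_χ` the line function of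
  `ChiLineInterpolation` (restriction of `L_{p,α}(σ_{A,K})(·, ψ⁰)` to `{χ·χ_F∘N}`), `d_F` converted
  by the Errata's remark (the derivative along `χ_F ↦ L_p(χ·χ_F∘q)` at `𝟙` is TWICE `d_F L_p(χ)`),
  the conormal value paired with `ℓ = log_p∘χ_cyc` and the derivative along the line written
  `D = d/ds|_{s=0} G_χ((⟨χ_cyc⟩^s)(γ) − 1) = ± log_p(γ)·[T¹]G_χ` (sign `σ₀ ∈ {±1}` = the
  geometric/arithmetic identification `Γ_ℚ ≅ Gal`, made explicit because `DH` is abstract — the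
  cluster's (c5)): `⟨d_F L_{p,α}(χ), ℓ⟩ = ½ D`. AT `p = 2`: `Γ_ℚ = ℤ₂^×/{±1} ≅ 1 + 4ℤ₂`,
  `γ = cyclotomicGenerator 2 = 5`, `ℓ = log₂` (`padicLog 2`), no other convention changes.
* THE CONJUNCTION (`ChiLineGrossZagierClauses`): `∃ Car > 0, ∃ G_χ` with
  `ChiLineInterpolation ι K f a χ_H 𝔭 𝔭′ Car G_χ` `∧ ∃ y₁ y₂ q σ₀, q ≠ 0 ∧ Arch ∧ PAdic` — the SAME `q`
  in both clauses (this is what carries content once `DH` is pinned: the `p`-adic and the archimedean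
  Gross–Zagier constants are then in the printed ratio `2 · Z°_p(χ)⁻¹ · (½log_p γ [T¹]G_χ)/(Car·L′)`),
  `q ≠ 0` the test-vector clause («`Q(f₁,f₂,χ) ≠ 0` for some `f₁, f₂`», [p4 L11] with Tunnell–Saito,
  granted `H(π_A(𝔹), χ) ≠ 0`, which is the definition of `𝔹`).

## Theorem B's hypotheses at `F = ℚ` (the binders of the consumer's conjoined statement)

`A = E/ℚ` an elliptic curve (`W`; `M = ℚ`, `ω = 𝟙`; modular: parametrised by `X(𝔹)` for the
incoherent `𝔹` of (1.1.1)); `K` imaginary quadratic, `p𝒪_K = 𝔭𝔭′` SPLIT («`E_v/F_v` is split»);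
«`A/F_v` has potentially `𝔭`-ordinary good or semistable reduction» — for the unramified unit
character of the companion file: `A` good ORDINARY at `p` (`IsOrdinaryAt`, `a = ι(unitRoot W p)`;
`HasPotentiallyGoodOrdinaryReductionAtPrime`) or multiplicative (`a = a_p = ±1`); `χ ∈ 𝒴^{l.c.}`:
finite order with `ω_A·χ|_{𝔸^{∞,×}} = 1`, i.e. `χ_H (AdeleRing.ideleBaseChange ℚ K x) = 1` for all
`x` (a ring class character); `ε(A_E, χ) = −1` (the sign; for road (C) its S1 stub); «`χ` is not
exceptional»: `IsNotExceptionalAt a χ_H 𝔭 ∧ IsNotExceptionalAt a χ_H 𝔭′` (companion file; for `χ_w`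
RAMIFIED at both places — the road-(C) case — this is the non-vanishing of two Gauss sums of
conductor exactly `2^{f(χ_w)}`). Under these, Theorem A + (1.1.3) + Theorem B (corrected) give
`ChiLineGrossZagierClauses ι K W H f a χ_H 𝔭 𝔭′ G χ DH` for `H ⊇` the field of the CM point, `G =
Gal(H/K)`, `χ` read on `G`, and `DH` = Disegni's (1.3.1)∘(log_p∘χ_cyc) on `E(H)` [p7 L48: =
Schneider = Mazur–Tate at non-exceptional `χ`]. ROAD (C): `H_χ` is ramified above `2`, so NO tree
canonicity predicate pins `DH` there; the road's conjoined stub transports `DH` to the member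
`W(ℚ)` (isogeny/restriction functoriality of Nekovář's heights — a separate print) where the (U5d)
receptacle pins it; a GL₂-type `B_{g″}` of dimension `> 1` has NO point/height carrier in the tree
(this file is typed for elliptic curves only) — `-- TODO(general form)`.

## What is NOT here

No CM point, no `X(𝔹)`, no `Q`, no Nekovář height as an object, no sign `ε(A_E,χ)` as an object, no
named fact. `-- TODO(general form): totally real F; A of GL₂-type with M ≠ ℚ (points of an abelian
-- variety and M-linear heights); the anticyclotomic formulas (Theorem C); a canonicity predicate for
-- the cyclotomic p-adic height over a number field H in which p is not totally split.`

## References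

* [Disegni2017] D. Disegni, *The `p`-adic Gross–Zagier formula on Shimura curves*, Compos. Math. 153
  (2017) 1987–2074 = arXiv:1510.02114v3: §1.1.1 (p3 L22–44), (1.1.2)–(1.1.4) (p4 L1–58), §1.3.1
  (1.3.1)–(1.3.2), Rem. 1.3.1, Def. 1.3.3 (p7 L16–50), §1.3.2 `𝒩*_{𝒴/𝒴′}`, `d_F`, Theorem B = Thm. 2
  (p8 L1–20), §4.1 (4.1.7) (PDF p. 39).
* [Disegni2023ShimuraII] D. Disegni, J. Inst. Math. Jussieu 22 (2023) = arXiv:1907.13040, §6 «Errata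
  to [1]» (p0021 L1–18).
* [YuanZhangZhang2013] X. Yuan, S.-W. Zhang, W. Zhang, *The Gross–Zagier formula on Shimura curves*,
  Ann. Math. Stud. 184 (2013), Thm. 1.2, §1.2.4, §7.1.1.
* Cluster/companions: `CyclotomicLineRankinSelberg.lean` §4 and §«Vacuity»; `ChiLineRankinSelberg.lean`;
  `CycLineGrossZagierFact.lean` (the conjoined-fact pattern); `CaiShuTian2014/ExplicitGrossZagierRingClass.lean`
  (`charHeegnerHeight`, `ringClassGal`, the ring-class reading).
* Cell: `run/shared/lean/pub/bsd-print-cf2/bsd-print-cf2-plan/TYPING-BRIEF-disegni-thmAB-g24.md` §2 (U5b),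
  §3 seams S1–S3; `ENTRY-TICKET-disegni-thmB-g24.md` §1–§2; `wake/SUMMON-bsd-print-cf2-ty2-…154423Z.md` (U5b′).
-/

noncomputable section

open scoped MatrixGroups ModularForm NumberField
open CongruenceSubgroup NumberField IsDedekindDomain WeierstrassCurve
open Literature.NumberTheory.GaloisRepresentations
open Literature.NumberTheory.EllipticCurves.ModularForms
open Literature.NumberTheory.Automorphic

namespace Literature.NumberTheory.EllipticCurves.Disegni2017

/-! ### §1 The `χ`-isotypic pairings of two `H`-points -/

section ChiPairings

open scoped Classical

variable {p : ℕ} [Fact p.Prime] (ι : PadicAlgCl p ≃+* ℂ) (W : WeierstrassCurve ℚ)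
  (H : Type) [Field H] [NumberField H]

/-- **The `χ`-isotypic Néron–Tate pairing of two points `y₁, y₂ ∈ E(H)`**:
`Σ_{σ ∈ G} χ(σ) · ⟨σy₁, y₂⟩_{NT,H}`, for a subgroup `G ≤ Aut(H/ℚ)` (standing for `Gal(H/K)`, e.g. the
tree's `ringClassGal ι c` on `H = ringClassField K ι c`) and a character `χ : G →* ℂˣ`, with the
tree's `heightPairing` on `E(H)` (Néron–Tate, normalised RELATIVE to `H`, no factor `½`) and the
Galois action `pointGalHom` (fed the classical `DecidableEq H`, the convention of `PAdicHeightDataK`). By bilinearity and `G`-invariance of the height this is `|G|` times the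
pairing `⟨e_χ y₁, e_{χ⁻¹} y₂⟩` of the `χ`- and `χ⁻¹`-isotypic projections
`e_χ y = |G|⁻¹ Σ_σ σ(y) ⊗ χ(σ)^{∓1}` — the shape of Disegni's
`P(f,χ) = ∫_{Gal(E^{ab}/E)} f(ι_ξ(P)^σ) ⊗ χ(σ) dσ ∈ A(χ)` for the `H`-point `y = f(ι_ξ P)` (the
multiple `|G|`, the volume-one Haar measure and the reciprocity normalisation are absorbed by the
consumer's `q`; for the ring-class case compare `CaiShuTian2014.charHeegnerHeight`, which is this sum
at `y₁ = y₂ = y` summed once more and divided by `[H:K]`). A complex number (real in fact).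
[cite: Disegni2017, §1.1.1 P(f,χ) and A(χ) (arXiv v3 PDF p. 3 L32–40); (1.1.3) (PDF p. 4 L35–41)] -/
def chiHeightPairing (G : Subgroup (H ≃ₐ[ℚ] H)) (χ : G →* ℂˣ)
    (y₁ y₂ : (W.baseChange H).toAffine.Point) : ℂ :=
  ∑ᶠ σ : G, ((χ σ : ℂˣ) : ℂ) * (((pointGalHom W H σ.1 y₁).heightPairing y₂ : ℝ) : ℂ)

/-- **The `χ`-isotypic `p`-adic pairing of two points `y₁, y₂ ∈ E(H)`** for a `p`-adic height datum
`DH` on `E(H)` (`PAdicHeightDataK W p H`; print: Disegni's pairing (1.3.1) on `A(H) ⊂ A(F̄)`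
composed with the ramified logarithm `ℓ = log_p ∘ χ_cyc : Γ_ℚ → ℚ_p` (Rem. 1.3.1), ABSOLUTELY
normalised — (4.1.7) `ℓ_w := [F′:F]⁻¹ ℓ_v ∘ N` —, which at a non-exceptional `χ` is the
Schneider / Mazur–Tate height [p7 L48]): `Σ_{σ ∈ G} ι⁻¹(χ(σ)) · ⟨σy₁, y₂⟩_{DH}` in `ℂ_p`. At `p = 2`:
`Γ_ℚ = ℤ₂^×/{±1} ≅ 1 + 4ℤ₂` and `ℓ = log₂`; the datum is abstract (the pairing is NOT asserted to be
canonical here — see the module docstring §«Vacuity and the consumer's conjunction»).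
[cite: Disegni2017, (1.3.1)–(1.3.2) and Rem. 1.3.1 (arXiv v3 PDF p. 7 L31–48); §4.1 (4.1.7) (PDF p. 39)] -/
def chiPAdicPairing (DH : PAdicHeightDataK W p H) (G : Subgroup (H ≃ₐ[ℚ] H)) (χ : G →* ℂˣ)
    (y₁ y₂ : (W.baseChange H).toAffine.Point) : ℂ_[p] :=
  ∑ᶠ σ : G, ((ι.symm ((χ σ : ℂˣ) : ℂ) : PadicAlgCl p) : ℂ_[p]) *
    algebraMap ℚ_[p] ℂ_[p] (DH.pairing (pointGalHom W H σ.1 y₁) y₂)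

variable {ι W H}

/-- Unfolding `chiHeightPairing`. [cite: Disegni2017, (1.1.3) (arXiv v3 PDF p. 4 L35–41)] -/
theorem chiHeightPairing_def (G : Subgroup (H ≃ₐ[ℚ] H)) (χ : G →* ℂˣ)
    (y₁ y₂ : (W.baseChange H).toAffine.Point) :
    chiHeightPairing W H G χ y₁ y₂ =
      ∑ᶠ σ : G, ((χ σ : ℂˣ) : ℂ) * (((pointGalHom W H σ.1 y₁).heightPairing y₂ : ℝ) : ℂ) := rfl

/-- Unfolding `chiPAdicPairing`. [cite: Disegni2017, (1.3.2) (arXiv v3 PDF p. 7 L40–44)] -/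
theorem chiPAdicPairing_def (DH : PAdicHeightDataK W p H) (G : Subgroup (H ≃ₐ[ℚ] H)) (χ : G →* ℂˣ)
    (y₁ y₂ : (W.baseChange H).toAffine.Point) :
    chiPAdicPairing ι W H DH G χ y₁ y₂ =
      ∑ᶠ σ : G, ((ι.symm ((χ σ : ℂˣ) : ℂ) : PadicAlgCl p) : ℂ_[p]) *
        algebraMap ℚ_[p] ℂ_[p] (DH.pairing (pointGalHom W H σ.1 y₁) y₂) := rfl

/-- The `χ`-isotypic `p`-adic pairing for the ZERO datum vanishes identically — the witness of the
vacuity of any `∃ DH`-form of Theorem B (module docstring §«Vacuity and the consumer's conjunction»).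
[cite: Disegni2017, Theorem B (arXiv v3 PDF p. 8 L11–18)] -/
theorem chiPAdicPairing_zero (G : Subgroup (H ≃ₐ[ℚ] H)) (χ : G →* ℂˣ)
    (y₁ y₂ : (W.baseChange H).toAffine.Point) :
    chiPAdicPairing ι W H (PAdicHeightDataK.zero : PAdicHeightDataK W p H) G χ y₁ y₂ = 0 := by
  simp [chiPAdicPairing, PAdicHeightDataK.zero]

/-- If `y₂` is torsion, the `χ`-isotypic `p`-adic pairing with `y₂` vanishes (height data vanish on
torsion). [cite: Disegni2017, §1.3.1 (arXiv v3 PDF p. 7 L18–19)] -/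
theorem chiPAdicPairing_of_isOfFinAddOrder (DH : PAdicHeightDataK W p H) (G : Subgroup (H ≃ₐ[ℚ] H))
    (χ : G →* ℂˣ) (y₁ : (W.baseChange H).toAffine.Point) {y₂ : (W.baseChange H).toAffine.Point}
    (hy₂ : IsOfFinAddOrder y₂) : chiPAdicPairing ι W H DH G χ y₁ y₂ = 0 := by
  simp [chiPAdicPairing, DH.map_torsion_right _ _ hy₂]

end ChiPairings

/-! ### §2 Theorem B ÷ YZZ (1.1.3) at the base point `χ` of the line: the two ratio clauses -/

section ChiRatio

open scoped Classical

variable {p : ℕ} [Fact p.Prime] (ι : PadicAlgCl p ≃+* ℂ) (K : Type) [Field K] [NumberField K]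
  {N : ℕ} (W : WeierstrassCurve ℚ) (H : Type) [Field H] [NumberField H]

/-- **(1.1.3) at `χ` in ratio form** (Yuan–Zhang–Zhang as quoted by Disegni, with Tunnell–Saito):
for the `H`-points `y₁, y₂` and the complex number `q` (`= c_E · Q(f₁,f₂,χ)` × the rational
normalisations of the projections; module docstring), and every entire continuation `Λ` of
`rankinSelbergEulerProductHecke f χ_H` (Disegni's `L(s − 1/2, σ_{A,E} ⊗ χ)`, `χ_H` the Hecke
incarnation of `χ`): `[H:ℚ]⁻¹ · Σ_σ χ(σ)⟨σy₁, y₂⟩_{NT,H} = (q/2) · Car · Λ′(1)` — `[H:ℚ]⁻¹`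
converting the tree's `H`-normalised `heightPairing` into YZZ's absolute one (§7.1.1; the cluster's
`½ = [K:ℚ]⁻¹`), `q/2` being (1.1.3)'s `(c_E/2)·Q`, `Car` the archimedean constant of Theorem A
(`π²/(2L(1,η)L(1,σ_A,ad))`). A PREDICATE. [cite: Disegni2017, (1.1.3)–(1.1.4) and the Tunnell–Saito paragraph (arXiv v3 PDF p. 4 L24–47)]
[cite: YuanZhangZhang2013, Thm. 1.2 and §7.1.1] -/
def ChiArchRatioClause (f : CuspForm (Gamma0 N) 2) (χH : HeckeCharacter K) (Car : ℝ)
    (G : Subgroup (H ≃ₐ[ℚ] H)) (χ : G →* ℂˣ) (y₁ y₂ : (W.baseChange H).toAffine.Point) (q : ℂ) :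
    Prop :=
  ∀ Λ : ℂ → ℂ, Differentiable ℂ Λ →
    (∀ s : ℂ, 2 < s.re → Λ s = rankinSelbergEulerProductHecke f χH s) →
    ((Module.finrank ℚ H : ℂ))⁻¹ * chiHeightPairing W H G χ y₁ y₂ = q / 2 * (Car : ℂ) * deriv Λ 1

/-- **Theorem B at `χ` in ratio form** (constant `c_E` as CORRECTED in the Errata; `d_F` converted
into HALF the derivative along the line `χ_F ↦ χ·χ_F∘q` by the Errata's remark; the conormal value
paired with `ℓ = log_p ∘ χ_cyc`, Rem. 1.3.1; module docstring §«Theorem B at χ»): for Disegni's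
datum `DH` on `E(H)`, the same `y₁, y₂, q` as in `ChiArchRatioClause`, the line function `G_χ` of
`ChiLineInterpolation` and a universal sign `σ₀`:
`Σ_σ ι⁻¹χ(σ)·⟨σy₁, y₂⟩_{DH} = σ₀ · ι⁻¹(q · Z°_p(χ_p)⁻¹) · ½ · log_p(γ) · [T¹]G_χ` in `ℂ_p`
(`Z°_p = zCirc`, `γ = cyclotomicGenerator p`, `= 5` at `p = 2`). A PREDICATE; vacuous on its own for
an abstract `DH` (`chiPAdicPairing_zero`).
[cite: Disegni2017, Theorem B = «Theorem 2» (arXiv v3 PDF p. 8 L11–20), Rem. 1.3.1 (PDF p. 7 L46), 𝒩*_{𝒴/𝒴′} and d_F (PDF p. 8 L1–7)]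
[cite: Disegni2023ShimuraII, §6 «Errata to [1]», Theorem B and the remark on d_F (arXiv:1907.13040, materialised p0021 L14–18)] -/
def ChiPAdicRatioClause (a : ℂ) (N' : ℕ) (χH : HeckeCharacter K) (𝔭 𝔭' : HeightOneSpectrum (𝓞 K))
    (Gχ : PowerSeries ℂ_[p]) (DH : PAdicHeightDataK W p H) (G : Subgroup (H ≃ₐ[ℚ] H))
    (χ : G →* ℂˣ) (y₁ y₂ : (W.baseChange H).toAffine.Point) (q : ℂ) (σ₀ : ℤˣ) : Prop :=
  chiPAdicPairing ι W H DH G χ y₁ y₂ =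
    ((σ₀ : ℤ) : ℂ_[p]) *
      ((ι.symm (q * (zCirc (p := p) a N' χH 𝔭 𝔭')⁻¹) : PadicAlgCl p) : ℂ_[p]) *
        algebraMap ℚ_[p] ℂ_[p] (2⁻¹ * padicLog p (cyclotomicGenerator p)) *
          PowerSeries.coeff 1 Gχ

/-- **Disegni 2017 Thm. A (on the line through `χ`) ∧ Thm. B ÷ YZZ (1.1.3) (at `χ`) for ONE
archimedean constant, ONE line function and ONE pair of `H`-points** — the Disegni-side conjunct of
a consumer's conjoined statement (module docstring §«Vacuity and the consumer's conjunction»): there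
are `Car > 0` and `G_χ` with `ChiLineInterpolation ι K f a χ_H 𝔭 𝔭′ Car G_χ`, and `y₁, y₂ ∈ E(H)`,
`q ≠ 0` (= the test-vector clause «`Q(f₁,f₂,χ) ≠ 0` for some `f₁, f₂`»), `σ₀ = ±1` with
`ChiArchRatioClause … y₁ y₂ q` and `ChiPAdicRatioClause … G_χ DH … y₁ y₂ q σ₀`. A PREDICATE in the
abstract `H`-datum `DH`. Under Theorem B's hypotheses at `F = ℚ` — `A = E` an elliptic curve over `ℚ`
parametrised by `X(𝔹)`, `K` imaginary quadratic with `p` split (`E_v/F_v` split), `A/ℚ_p` potentially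
`p`-ordinary good or semistable (here: good ordinary or multiplicative, `a = ι(α)`), `χ ∈ 𝒴^{l.c.}`
(`χ_H|_{𝔸_ℚ^×} = 1`, a ring class character) cut out by `H` with Hecke incarnation `χ_H`,
`ε(A_K, χ) = −1`, `χ` NOT EXCEPTIONAL at `𝔭` and `𝔭′` (`IsNotExceptionalAt a χ_H 𝔭`, `… 𝔭′`) — the
printed theorems give it for Disegni's datum. [cite: Disegni2017, Theorem A (arXiv v3 PDF pp. 6–7), Theorem B (PDF p. 8 L11–20), (1.1.3) (PDF p. 4 L35–41), (4.1.7) (PDF p. 39)]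
[cite: Disegni2023ShimuraII, §6 «Errata to [1]» (arXiv:1907.13040, materialised p0021 L8–18)] [cite: YuanZhangZhang2013, Thm. 1.2, §7.1.1] -/
def ChiLineGrossZagierClauses [IsGalois ℚ K] (f : CuspForm (Gamma0 N) 2) (a : ℂ)
    (χH : HeckeCharacter K) (𝔭 𝔭' : HeightOneSpectrum (𝓞 K)) (G : Subgroup (H ≃ₐ[ℚ] H))
    (χ : G →* ℂˣ) (DH : PAdicHeightDataK W p H) : Prop :=
  ∃ Car : ℝ, 0 < Car ∧ ∃ Gχ : PowerSeries ℂ_[p], ChiLineInterpolation ι K f a χH 𝔭 𝔭' Car Gχ ∧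
    ∃ (y₁ y₂ : (W.baseChange H).toAffine.Point) (q : ℂ) (σ₀ : ℤˣ), q ≠ 0 ∧
      ChiArchRatioClause K W H f χH Car G χ y₁ y₂ q ∧
        ChiPAdicRatioClause ι K W H a N χH 𝔭 𝔭' Gχ DH G χ y₁ y₂ q σ₀

/-! #### API -/

variable {ι K W H}

/-- Unfolding `ChiPAdicRatioClause`. [cite: Disegni2017, Theorem B (arXiv v3 PDF p. 8 L11–20)] -/
theorem chiPAdicRatioClause_iff (a : ℂ) (N' : ℕ) (χH : HeckeCharacter K)
    (𝔭 𝔭' : HeightOneSpectrum (𝓞 K)) (Gχ : PowerSeries ℂ_[p]) (DH : PAdicHeightDataK W p H)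
    (G : Subgroup (H ≃ₐ[ℚ] H)) (χ : G →* ℂˣ) (y₁ y₂ : (W.baseChange H).toAffine.Point) (q : ℂ)
    (σ₀ : ℤˣ) :
    ChiPAdicRatioClause ι K W H a N' χH 𝔭 𝔭' Gχ DH G χ y₁ y₂ q σ₀ ↔
      chiPAdicPairing ι W H DH G χ y₁ y₂ =
        ((σ₀ : ℤ) : ℂ_[p]) *
          ((ι.symm (q * (zCirc (p := p) a N' χH 𝔭 𝔭')⁻¹) : PadicAlgCl p) : ℂ_[p]) *
            algebraMap ℚ_[p] ℂ_[p] (2⁻¹ * padicLog p (cyclotomicGenerator p)) *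
              PowerSeries.coeff 1 Gχ :=
  Iff.rfl

/-- Unfolding `ChiArchRatioClause` at one continuation. [cite: Disegni2017, (1.1.3) (arXiv v3 PDF p. 4 L35–41)] -/
theorem ChiArchRatioClause.eq {f : CuspForm (Gamma0 N) 2} {χH : HeckeCharacter K} {Car : ℝ}
    {G : Subgroup (H ≃ₐ[ℚ] H)} {χ : G →* ℂˣ} {y₁ y₂ : (W.baseChange H).toAffine.Point} {q : ℂ}
    (h : ChiArchRatioClause K W H f χH Car G χ y₁ y₂ q) {Λ : ℂ → ℂ} (hΛ : Differentiable ℂ Λ)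
    (hΛ' : ∀ s : ℂ, 2 < s.re → Λ s = rankinSelbergEulerProductHecke f χH s) :
    ((Module.finrank ℚ H : ℂ))⁻¹ * chiHeightPairing W H G χ y₁ y₂ =
      q / 2 * (Car : ℂ) * deriv Λ 1 :=
  h Λ hΛ hΛ'

/-- The pieces of `ChiLineGrossZagierClauses`. [cite: Disegni2017, Theorem A/B (arXiv v3 PDF pp. 6–8)] -/
theorem ChiLineGrossZagierClauses.exists_interpolation [IsGalois ℚ K] {f : CuspForm (Gamma0 N) 2}
    {a : ℂ} {χH : HeckeCharacter K} {𝔭 𝔭' : HeightOneSpectrum (𝓞 K)}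
    {G : Subgroup (H ≃ₐ[ℚ] H)} {χ : G →* ℂˣ} {DH : PAdicHeightDataK W p H}
    (h : ChiLineGrossZagierClauses ι K W H f a χH 𝔭 𝔭' G χ DH) :
    ∃ Car : ℝ, 0 < Car ∧ ∃ Gχ : PowerSeries ℂ_[p], ChiLineInterpolation ι K f a χH 𝔭 𝔭' Car Gχ :=
  let ⟨Car, hCar, Gχ, hG, _⟩ := h
  ⟨Car, hCar, Gχ, hG⟩

/-- **The `p`-adic clause kills the zero datum whenever the analytic side is non-zero**: if
`ChiLineGrossZagierClauses` holds for the ZERO datum then `[T¹]G_χ = 0` for its line function (or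
`log_p γ = 0`, which is false) — i.e. an `∃ DH`-form of Theorem B carries only the content «the
cyclotomic derivative at `χ` vanishes», the vacuity the module docstring warns about; stated as the
implication it is. [cite: Disegni2017, Theorem B (arXiv v3 PDF p. 8 L11–20)] -/
theorem ChiPAdicRatioClause.coeff_one_eq_zero_of_zero {a : ℂ} {N' : ℕ} {χH : HeckeCharacter K}
    {𝔭 𝔭' : HeightOneSpectrum (𝓞 K)} {Gχ : PowerSeries ℂ_[p]} {G : Subgroup (H ≃ₐ[ℚ] H)}
    {χ : G →* ℂˣ} {y₁ y₂ : (W.baseChange H).toAffine.Point} {q : ℂ} {σ₀ : ℤˣ}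
    (h : ChiPAdicRatioClause ι K W H a N' χH 𝔭 𝔭' Gχ (PAdicHeightDataK.zero : PAdicHeightDataK W p H)
      G χ y₁ y₂ q σ₀)
    (hq : ((ι.symm (q * (zCirc (p := p) a N' χH 𝔭 𝔭')⁻¹) : PadicAlgCl p) : ℂ_[p]) ≠ 0)
    (hlog : padicLog p (cyclotomicGenerator p) ≠ 0) :
    PowerSeries.coeff 1 Gχ = 0 := by
  rw [ChiPAdicRatioClause, chiPAdicPairing_zero] at h
  have hσ : ((σ₀ : ℤ) : ℂ_[p]) ≠ 0 := by exact_mod_cast Units.ne_zero σ₀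
  have h2 : algebraMap ℚ_[p] ℂ_[p] (2⁻¹ * padicLog p (cyclotomicGenerator p)) ≠ 0 := by
    rw [map_ne_zero_iff _ (algebraMap ℚ_[p] ℂ_[p]).injective]
    exact mul_ne_zero (inv_ne_zero two_ne_zero) hlog
  have := h.symm
  rw [mul_eq_zero, mul_eq_zero, mul_eq_zero] at this
  rcases this with ((h1 | h1) | h1) | h1
  · exact absurd h1 hσ
  · exact absurd h1 hq
  · exact absurd h1 h2
  · exact h1

end ChiRatio

end Literature.NumberTheory.EllipticCurves.Disegni2017

end
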